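import Literature.MathematicalPhysics.QuantumFieldTheory.King1986.MinimizerHolderDecayUniform
import HarnessLib

/-!
# King 1986, Proposition 3.8 (3.71), THIRD AND FOURTH LINES IN THEIR PRINTED SHAPE `≦ CL^{−γk}exp[−δ₀dist({x, y}, z)]` for the
# ACTUAL minimiser kernels `ℋ_K` and `∂^η_μℋ_K` — the two-spacing Hölder-quotient rates of `MinimizerHolderDecay` §4 ∕ §6 with
# the constants `(δ, c)` UNIFORM IN THE MASS `0 < m² ≤ m₀²`

**Citation header (reproduction of PUBLISHED and PROVED work; seat `pub-ymgap-dag-n18-e` (generation 26) of the cell `pub-ymgap`,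
Track-A node N18 = NE5, row s3 «King-model transfer»; a mass-uniform re-run of the two theorems of n18-b's `MinimizerHolderDecay`
that its mass-uniform companion `MinimizerHolderDecayUniform` (seat n15-e, generation 9) lists under NOT COVERED: «the two-spacing
lines 3–4 of (3.71) (`king_prop38_holder(_deriv)_torus_blocks`, mass still outside there)».)**
C. King, *The U(1) Higgs model. I. The continuum limit*, Commun. Math. Phys. **102** (1986) 649–677 [King1986]: Prop. 3.8 (3.71)
p. 664, third and fourth lines (the Hölder quotients `∂_α(x, y)` of `a_kG^η_kQ^*_k` and of `a_k∂^η_μG^η_kQ^*_k` at two lattice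
spacings, right-hand side `CL^{−γk}exp[−δ₀dist({x, y}, z)]`), p. 674 «combining our bounds with Theorem 3.3 we deduce (3.71)»;
Theorem 3.3 (3.8) p. 658 («see [Ba 4]»; constants «independent of … the lattice spacing»); (2.20) p. 654 (the slice of scale `j`
carries, in its own lattice units, the mass `m²(L^jη)²`).  T. Bałaban, *Regularity and decay of lattice Green's functions*,
CMP **89** (1983) [Balaban1983RegularityDecay], Theorem (1.9)–(1.10) p. 573 (constants «depending on d, M only, c₀ on α also» —
NOT on the mass).  King's paper is TEMPLATE LITERATURE (printed and proved `A = 0` mechanism); nothing here is about Bałaban's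
covariant objects.

**Why the mass must sit inside the `∃`.**  King's (3.73) ∕ (3.75) sum the pieces `ℋ_jC^{(j)}ℋ_jᵀ` of (2.17) over scales `j`; read
in the units of scale `j` the piece carries the mass `m²(L^jη)²` ((2.20)), a different number at every scale, all in `(0, m²]` —
so a bound summed over `j` needs ONE pair `(δ, c)` for all masses under a cap.  `MinimizerHolderDecay.king_prop38_holder_torus_blocks`
∕ `king_prop38_holder_deriv_torus_blocks` fix `m²` before producing `(δ, c)`.  Their inputs are (i) the sup-norm two-spacing rates
`MinimizerTwoSpacingHolder.king_prop38_holder_torus` ∕ `king_prop38_holder_deriv_torus`, which hold for EVERY `m² > 0` with the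
EXPLICIT, mass-free constants `C₁ + C₂ = fprop38RateConst … + fprop38PosConst …` (nothing to re-run), and (ii) the Hölder-quotient
decays `holder_kernel_decay_blocks` ∕ `holder_dkernel_decay_blocks`, whose mass-uniform editions `holder_kernel_decay_blocks_unif`
∕ `holder_dkernel_decay_blocks_unif` (`MinimizerHolderDecayUniform`) are in the tree.  The proofs below are n18-b's §4 ∕ §6
verbatim, on the `_unif` decay inputs.

**What this file PROVES (kernel; 0 `def`, 0 `sorry`).**  With `ρ = |x − y|` the sup torus distance in unit coordinates
(`holdist`), `ℋ_K = minimiser N M a_K N² m²` the ACTUAL operator, `B(x)` the unit block under `x`, `x′, y′` fine points of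
`T_{η′}` (`L^nL^K` per unit side) over `x, y ∈ T_η` (`L^K`):
* **`king_prop38_holder_torus_blocks_unif`** — for `d ≥ 1`, odd `L ≥ 2`, `a > 0`, `m₀² ≥ 0`, `0 < α`, `0 < γ`, `α + γ ≤ 1`
  there are `δ, c > 0` (functions of `d, L, a, m₀², α`) such that for EVERY `0 < m² ≤ m₀²`, every volume (`K ≥ 1`), every
  `n ≥ 1`, every `x, y, b`: `|(∂_α(x′,y′)ℋ_{K+n})(b) − (∂_α(x,y)ℋ_K)(b)| ≤ √((C₁ + C₂)(L^K)^{−γ}·2c)·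
  exp(−(δ∕2)·min(|B(x) − b|, |B(y) − b|))` — King's (3.71) LINE 3 in its printed shape, one pair of constants for all masses.
* **`king_prop38_holder_deriv_torus_blocks_unif`** — the same for LINE 4 (`∂^η_μ` inside the Hölder quotient, `α + γ < 1`).

**NOT COVERED.**  `m² = 0`; even `L`; `α = 0` (that is line 1 ∕ 2: `MinimizerDecayUniform.king_prop38_torus_blocks_unif`,
`MinimizerTwoSpacingDerivUniform.king_prop38_deriv_torus_blocks_unif`); Euclidean in place of sup distances; unit tori other than
`2L^m` for the decay; `A ≠ 0`; (3.74) (the contour operator `G(Γ, b)` — not a scalar-template object).  HONEST FRAMING: King's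
`A = 0` scalar MODEL — template literature on a finite torus; nothing about Bałaban's covariant objects; nothing continuum ∕
mass-gap ∕ Clay; count-neutral for the cell's 27 nodes.
-/

noncomputable section

open Finset Real Matrix
open scoped BigOperators ComplexConjugate

namespace Literature.MathematicalPhysics.QuantumFieldTheory.King1986

open Literature.MathematicalPhysics.QuantumFieldTheory.Balaban1983to89 (Params)
open Literature.MathematicalPhysics.QuantumFieldTheory.Balaban1983to89.B5Prop11Plancherel

namespace Torus

variable {d : ℕ}

/-! ## §1 (3.71), third line, in its printed shape — constants uniform in the mass -/

/-- **KING'S (3.71), THIRD LINE, IN ITS PRINTED SHAPE, FOR THE ACTUAL OPERATORS ON BAŁABAN'S VOLUMES — CONSTANTS UNIFORM IN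
THE MASS.**  For `d ≥ 1`, odd `L ≥ 2`, `a > 0`, a cap `m₀² ≥ 0`, `0 < α`, `0 < γ`, `α + γ ≤ 1` there are `δ, c > 0` (functions of
`d, L, a, m₀², α` only; the pair of `holder_kernel_decay_blocks_unif`) such that for EVERY mass `0 < m² ≤ m₀²`, every volume
`P = (d, L, m, K)` (`K ≥ 1`), every `n ≥ 1`, the unit torus `M_μ = 2L^m`, fine points `x′, y′` over `x, y` and every unit site `b`:
`||x′ − y′|^{−α}(ℋ_{K+n}(x′,b) − ℋ_{K+n}(y′,b)) − |x − y|^{−α}(ℋ_K(x,b) − ℋ_K(y,b))| ≤ √((C₁ + C₂)·(L^K)^{−γ}·2c)·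
exp(−(δ∕2)·min(|B(x) − b|, |B(y) − b|))` — `C₁, C₂` the (mass-free) constants of `king_prop38_holder_torus` (`θ = lemma43Const a L K n`).
Mass-uniform twin of `king_prop38_holder_torus_blocks` (same proof: the per-mass sup rate interpolated, `abs_le_sqrt_mul_exp_half`,
with the mass-uniform Hölder decay of both runs, whose blocks agree by `blockOf_over`).
[cite: King1986, Prop. 3.8 (3.71) p.664, p.674, (2.20) p.654; Balaban1983RegularityDecay, Theorem (1.10) p.573] -/
theorem king_prop38_holder_torus_blocks_unif (dd L : ℕ) (hd : 1 ≤ dd) (hLodd : Odd L) (hL : 2 ≤ L) {a : ℝ} (ha : 0 < a)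
    {m0sq : ℝ} (hm0 : 0 ≤ m0sq) {α γ : ℝ} (hα : 0 < α) (hγ : 0 < γ) (hαγ : α + γ ≤ 1) :
    ∃ δ c : ℝ, 0 < δ ∧ 0 < c ∧ ∀ (P : Params) (_hPd : P.d = dd) (_hPL : P.L = L) (_hK : 1 ≤ P.K) [NeZero P.L]
      (m2 : ℝ) (_hm : 0 < m2) (_hcap : m2 ≤ m0sq)
      (n : ℕ) (_hn : 1 ≤ n) (M : Fin P.d → ℕ) [∀ μ, NeZero (M μ)] (_hMK : ∀ μ, M μ = P.sitesPerDir P.K)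
      (xt yt : Tor (fine (P.L ^ P.K) M)) (xt' yt' : Tor (fine (P.L ^ n * P.L ^ P.K) M)) (bt : Tor M)
      (_hxx : ∀ μ, (xt μ).val = (xt' μ).val / P.L ^ n) (_hyy : ∀ μ, (yt μ).val = (yt' μ).val / P.L ^ n),
      |(holdist (P.L ^ n * P.L ^ P.K) M xt' yt') ^ (-α)
          * (minimiser (P.L ^ n * P.L ^ P.K) M (aK a P.L (P.K + n)) (((P.L ^ n * P.L ^ P.K : ℕ) : ℝ) ^ 2) m2
              (Pi.single bt 1) xt'
            - minimiser (P.L ^ n * P.L ^ P.K) M (aK a P.L (P.K + n)) (((P.L ^ n * P.L ^ P.K : ℕ) : ℝ) ^ 2) m2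
              (Pi.single bt 1) yt')
        - (holdist (P.L ^ P.K) M xt yt) ^ (-α)
          * (minimiser (P.L ^ P.K) M (aK a P.L P.K) (((P.L ^ P.K : ℕ) : ℝ) ^ 2) m2 (Pi.single bt 1) xt
            - minimiser (P.L ^ P.K) M (aK a P.L P.K) (((P.L ^ P.K : ℕ) : ℝ) ^ 2) m2 (Pi.single bt 1) yt)|
        ≤ Real.sqrt (((fprop38RateConst a a (lemma43Const a P.L P.K n) ((π ^ 2 / 4) ^ P.d) P.d γ α
                  (2 * (P.d : ℝ) ^ α) 0
                + fprop38PosConst a ((π ^ 2 / 4) ^ P.d) P.d γ α (2 * (P.d : ℝ) ^ α) (6 * (P.d : ℝ) ^ (α + γ)))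
              * ((P.L ^ P.K : ℕ) : ℝ) ^ (-γ)) * (2 * c))
          * Real.exp (-(δ / 2 * min (tdistT M (blockOf (P.L ^ P.K) M xt) bt) (tdistT M (blockOf (P.L ^ P.K) M yt) bt))) := by
  have hα1 : α < 1 := by linarith
  obtain ⟨δ, c, hδ, hc, H⟩ := holder_kernel_decay_blocks_unif dd L hd hLodd hL ha hm0 hα hα1
  refine ⟨δ, c, hδ, hc, ?_⟩
  intro P hPd hPL hK _ m2 hm hcap n hn M _ hMK xt yt xt' yt' bt hxx hyy
  have hPd0 : 0 < P.d := by have := P.hd; omega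
  have hPodd : Odd P.L := P.hL.1
  have hPL2 : 2 ≤ P.L := by have := P.hL.2; omega
  set m := min (tdistT M (blockOf (P.L ^ P.K) M xt) bt) (tdistT M (blockOf (P.L ^ P.K) M yt) bt) with hmdef
  -- run A, at this mass, with the mass-uniform constants
  have hA := H P hPd hPL hK m2 hm hcap M hMK (P.L ^ P.K) rfl xt yt bt
  -- run B on the volume `(d, L, m, K + n)`: same blocks
  have hMK' : ∀ ν, M ν = (⟨P.d, P.L, P.m, P.K + n, P.hd, P.hL⟩ : Params).sitesPerDir (P.K + n) := fun ν => by
    rw [hMK ν]; exact (sitesPerDir_finerVolume P n).symm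
  have hN : P.L ^ n * P.L ^ P.K = P.L ^ (P.K + n) := by rw [pow_add, mul_comm]
  have hB := H (⟨P.d, P.L, P.m, P.K + n, P.hd, P.hL⟩ : Params) hPd hPL (show 1 ≤ P.K + n by omega) m2 hm hcap M hMK'
    (P.L ^ n * P.L ^ P.K) hN xt' yt' bt
  rw [blockOf_over M xt xt' hxx, blockOf_over M yt yt' hyy] at hB
  -- the sup rate at this mass (its constants are mass-free)
  have hrate := king_prop38_holder_torus hPd0 hPodd hPL2 hK hn M ha hm hα.le hγ hαγ bt xt yt xt' yt' hxx hyy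
  have hε : 0 ≤ (fprop38RateConst a a (lemma43Const a P.L P.K n) ((π ^ 2 / 4) ^ P.d) P.d γ α (2 * (P.d : ℝ) ^ α) 0
      + fprop38PosConst a ((π ^ 2 / 4) ^ P.d) P.d γ α (2 * (P.d : ℝ) ^ α) (6 * (P.d : ℝ) ^ (α + γ)))
      * ((P.L ^ P.K : ℕ) : ℝ) ^ (-γ) := (abs_nonneg _).trans hrate
  refine abs_le_sqrt_mul_exp_half hε hrate ?_
  calc _ ≤ |(holdist (P.L ^ n * P.L ^ P.K) M xt' yt') ^ (-α)
            * (minimiser (P.L ^ n * P.L ^ P.K) M (aK a P.L (P.K + n)) (((P.L ^ n * P.L ^ P.K : ℕ) : ℝ) ^ 2) m2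
                (Pi.single bt 1) xt'
              - minimiser (P.L ^ n * P.L ^ P.K) M (aK a P.L (P.K + n)) (((P.L ^ n * P.L ^ P.K : ℕ) : ℝ) ^ 2) m2
                (Pi.single bt 1) yt')|
        + |(holdist (P.L ^ P.K) M xt yt) ^ (-α)
            * (minimiser (P.L ^ P.K) M (aK a P.L P.K) (((P.L ^ P.K : ℕ) : ℝ) ^ 2) m2 (Pi.single bt 1) xt
              - minimiser (P.L ^ P.K) M (aK a P.L P.K) (((P.L ^ P.K : ℕ) : ℝ) ^ 2) m2 (Pi.single bt 1) yt)| :=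
        abs_sub _ _
    _ ≤ c * Real.exp (-(δ * m)) + c * Real.exp (-(δ * m)) := add_le_add hB hA
    _ = 2 * c * Real.exp (-(δ * m)) := by ring

/-! ## §2 (3.71), fourth line, in its printed shape — constants uniform in the mass -/

/-- **KING'S (3.71), FOURTH LINE, IN ITS PRINTED SHAPE, FOR THE ACTUAL OPERATORS ON BAŁABAN'S VOLUMES — CONSTANTS UNIFORM IN
THE MASS.**  For `d ≥ 1`, odd `L ≥ 2`, `a > 0`, a cap `m₀² ≥ 0`, `0 < α`, `0 < γ`, `α + γ < 1` there are `δ, c > 0` (functions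
of `d, L, a, m₀², α`; the pair of `holder_dkernel_decay_blocks_unif`) such that for EVERY mass `0 < m² ≤ m₀²`, every volume
(`K ≥ 1`), `n ≥ 1`, the unit torus `2L^m`, fine points `x′, y′` over `x, y`, every `b`, `μ`:
`||x′ − y′|^{−α}(∂^{η′}_μℋ_{K+n}(x′,b) − ∂^{η′}_μℋ_{K+n}(y′,b)) − |x − y|^{−α}(∂^η_μℋ_K(x,b) − ∂^η_μℋ_K(y,b))| ≤
√((C₁ + C₂)·(L^K)^{−γ}·2c)·exp(−(δ∕2)·min(|B(x) − b|, |B(y) − b|))` with `C₁, C₂` the (mass-free) constants of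
`king_prop38_holder_deriv_torus`.  Mass-uniform twin of `king_prop38_holder_deriv_torus_blocks` (same proof).
[cite: King1986, Prop. 3.8 (3.71) p.664, p.674, (2.20) p.654; Balaban1983RegularityDecay, Theorem (1.9) p.573] -/
theorem king_prop38_holder_deriv_torus_blocks_unif (dd L : ℕ) (hd : 1 ≤ dd) (hLodd : Odd L) (hL : 2 ≤ L) {a : ℝ}
    (ha : 0 < a) {m0sq : ℝ} (hm0 : 0 ≤ m0sq) {α γ : ℝ} (hα : 0 < α) (hγ : 0 < γ) (hαγ : α + γ < 1) :
    ∃ δ c : ℝ, 0 < δ ∧ 0 < c ∧ ∀ (P : Params) (_hPd : P.d = dd) (_hPL : P.L = L) (_hK : 1 ≤ P.K) [NeZero P.L]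
      (m2 : ℝ) (_hm : 0 < m2) (_hcap : m2 ≤ m0sq)
      (n : ℕ) (_hn : 1 ≤ n) (M : Fin P.d → ℕ) [∀ μ, NeZero (M μ)] (_hMK : ∀ μ, M μ = P.sitesPerDir P.K)
      (xt yt : Tor (fine (P.L ^ P.K) M)) (xt' yt' : Tor (fine (P.L ^ n * P.L ^ P.K) M)) (bt : Tor M)
      (_hxx : ∀ μ, (xt μ).val = (xt' μ).val / P.L ^ n) (_hyy : ∀ μ, (yt μ).val = (yt' μ).val / P.L ^ n) (μ : Fin P.d),
      |(holdist (P.L ^ n * P.L ^ P.K) M xt' yt') ^ (-α)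
          * (((P.L ^ n * P.L ^ P.K : ℕ) : ℝ)
              * (minimiser (P.L ^ n * P.L ^ P.K) M (aK a P.L (P.K + n)) (((P.L ^ n * P.L ^ P.K : ℕ) : ℝ) ^ 2) m2
                  (Pi.single bt 1) (xt' + unitVec (fine (P.L ^ n * P.L ^ P.K) M) μ)
                - minimiser (P.L ^ n * P.L ^ P.K) M (aK a P.L (P.K + n)) (((P.L ^ n * P.L ^ P.K : ℕ) : ℝ) ^ 2) m2
                  (Pi.single bt 1) xt')
            - ((P.L ^ n * P.L ^ P.K : ℕ) : ℝ)
              * (minimiser (P.L ^ n * P.L ^ P.K) M (aK a P.L (P.K + n)) (((P.L ^ n * P.L ^ P.K : ℕ) : ℝ) ^ 2) m2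
                  (Pi.single bt 1) (yt' + unitVec (fine (P.L ^ n * P.L ^ P.K) M) μ)
                - minimiser (P.L ^ n * P.L ^ P.K) M (aK a P.L (P.K + n)) (((P.L ^ n * P.L ^ P.K : ℕ) : ℝ) ^ 2) m2
                  (Pi.single bt 1) yt'))
        - (holdist (P.L ^ P.K) M xt yt) ^ (-α)
          * (((P.L ^ P.K : ℕ) : ℝ)
              * (minimiser (P.L ^ P.K) M (aK a P.L P.K) (((P.L ^ P.K : ℕ) : ℝ) ^ 2) m2 (Pi.single bt 1)
                  (xt + unitVec (fine (P.L ^ P.K) M) μ)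
                - minimiser (P.L ^ P.K) M (aK a P.L P.K) (((P.L ^ P.K : ℕ) : ℝ) ^ 2) m2 (Pi.single bt 1) xt)
            - ((P.L ^ P.K : ℕ) : ℝ)
              * (minimiser (P.L ^ P.K) M (aK a P.L P.K) (((P.L ^ P.K : ℕ) : ℝ) ^ 2) m2 (Pi.single bt 1)
                  (yt + unitVec (fine (P.L ^ P.K) M) μ)
                - minimiser (P.L ^ P.K) M (aK a P.L P.K) (((P.L ^ P.K : ℕ) : ℝ) ^ 2) m2 (Pi.single bt 1) yt))|
        ≤ Real.sqrt (((fprop38RateConst a a (lemma43Const a P.L P.K n) ((π ^ 2 / 4) ^ P.d) P.d γ (α + 1)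
                  (2 * (P.d : ℝ) ^ α) (2 * (P.d : ℝ) ^ α * 2 ^ (1 - γ))
                + fprop38PosConst a ((π ^ 2 / 4) ^ P.d) P.d γ (α + 1) (2 * (P.d : ℝ) ^ α) (6 * (P.d : ℝ) ^ (α + γ)))
              * ((P.L ^ P.K : ℕ) : ℝ) ^ (-γ)) * (2 * c))
          * Real.exp (-(δ / 2 * min (tdistT M (blockOf (P.L ^ P.K) M xt) bt) (tdistT M (blockOf (P.L ^ P.K) M yt) bt))) := by
  have hα1 : α < 1 := by linarith
  obtain ⟨δ, c, hδ, hc, H⟩ := holder_dkernel_decay_blocks_unif dd L hd hLodd hL ha hm0 hα hα1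
  refine ⟨δ, c, hδ, hc, ?_⟩
  intro P hPd hPL hK _ m2 hm hcap n hn M _ hMK xt yt xt' yt' bt hxx hyy μ
  have hPd0 : 0 < P.d := by have := P.hd; omega
  have hPodd : Odd P.L := P.hL.1
  have hPL2 : 2 ≤ P.L := by have := P.hL.2; omega
  set m := min (tdistT M (blockOf (P.L ^ P.K) M xt) bt) (tdistT M (blockOf (P.L ^ P.K) M yt) bt) with hmdef
  -- run A, at this mass, with the mass-uniform constants
  have hA := H P hPd hPL hK m2 hm hcap M hMK (P.L ^ P.K) rfl xt yt bt μ
  -- run B on the volume `(d, L, m, K + n)`: same blocks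
  have hMK' : ∀ ν, M ν = (⟨P.d, P.L, P.m, P.K + n, P.hd, P.hL⟩ : Params).sitesPerDir (P.K + n) := fun ν => by
    rw [hMK ν]; exact (sitesPerDir_finerVolume P n).symm
  have hN : P.L ^ n * P.L ^ P.K = P.L ^ (P.K + n) := by rw [pow_add, mul_comm]
  have hB := H (⟨P.d, P.L, P.m, P.K + n, P.hd, P.hL⟩ : Params) hPd hPL (show 1 ≤ P.K + n by omega) m2 hm hcap M hMK'
    (P.L ^ n * P.L ^ P.K) hN xt' yt' bt μ
  rw [blockOf_over M xt xt' hxx, blockOf_over M yt yt' hyy] at hB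
  push_cast at hA hB ⊢
  -- the sup rate at this mass (its constants are mass-free)
  have hrate := king_prop38_holder_deriv_torus hPd0 hPodd hPL2 hK hn M ha hm hα.le hγ hαγ bt xt yt xt' yt' hxx hyy μ
  push_cast at hrate
  have hε := (abs_nonneg _).trans hrate
  refine abs_le_sqrt_mul_exp_half hε hrate ?_
  calc _ ≤ _ + _ := abs_sub _ _
    _ ≤ c * Real.exp (-(δ * m)) + c * Real.exp (-(δ * m)) := add_le_add hB hA
    _ = 2 * c * Real.exp (-(δ * m)) := by ring

end Torus

end Literature.MathematicalPhysics.QuantumFieldTheory.King1986
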